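import Literature.Computability.FineGrained.FineGrainedWave0Proofs
import Literature.Computability.FineGrained.SATBruteForceRename
import Literature.Computability.FineGrained.SATBruteForceCount
import Literature.Computability.Complexity.TM2IterateFST
import Literature.Computability.Complexity.TimeBoundsProofs
import HarnessLib

/-!
# Brute-force `k`-SAT: the machine (`k`-SAT ∈ TIME(`2ⁿ · poly(L)`))

Trunk `CplxCore` / family `fine-grained`. Third and last file of the brute-force
satisfiability decider behind the named fact `Literature.Computability.FineGrained.kSATInExpTime_one`
(Impagliazzo–Paturi 2001, §1, p. 368: `s_k` is the infimum of the exponents `δ` of `O(2^{δn})`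
algorithms for `k`-SAT; that exhaustive search puts `1` in this set is implicit there, and
exhaustive search over assignments is step 1 of their algorithm proving Theorem 3, p. 374). The decider is a pipeline of five stages over Mathlib's multi-stack machines,
composed by `Turing.TM2ComputableAux.comp` (running times add, `comp_outputsWithin`):

* `inFST` (a finite-state transducer, `Transducers.lean`): reads the encoding `φ.encode` of a
  `k`-CNF (`FineGrainedWave0.lean`) and lays out the initial state of the renaming stage,
  interleaved with `2L` clock ticks (`inFST_eval`, `countP_isNone_inFST_eval`,
  `reduceOption_inFST_eval`; as in `TM2IterateFST.lean`, the *ticks* of a mixed word are its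
  `none`s, `List.countP Option.isNone`, and its *data* is `List.reduceOption`);
* the loop machine of `renFST` (`SATBruteForceRename.lean`, iterated with an interleaved
  clock by `FST.exists_iterate_outputsWithin`, `TM2IterateFST.lean`): ranks the `v` distinct
  occurring variables and doubles a unit block once per rank (`2^v` units);
* `faFST`: turns the units into the `2^v` clock ticks of the next stage and the ranked
  literals into counter cells (`reduceOption_faFST_eval`, `countP_isNone_faFST_eval`);
* the loop machine of `countFST` (`SATBruteForceCount.lean`): one pass per assignment of the
  `v` ranked variables;
* `outFST`: extracts the answer bit.

Main results: `exists_outputsWithin_decide` — one machine decides satisfiability of every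
`k`-CNF, for every `k`, within `79 · 2ⁿ · (L + 1)³` steps (`n = numVars`, `L = |φ.encode|`;
the semantic bridge is `exists_formVal_skel_iff`), and the discharge
`Literature.FineGrained.kSATInExpTime_one_holds : kSATInExpTime_one`. With the order-theoretic glue of
`FineGrainedWave0Proofs.lean` this discharges the elementary named facts of the statement file
outright — `satExponent_mem_Icc_holds` (`0 ≤ s_k ≤ 1`), `monotone_satExponent_holds`,
`eth_iff_satExponent_pos_holds` (**fine-grained.S02**, `ETH ↔ s_3 > 0`),
`seth_iff_satExponentLimit_eq_one_holds` (**fine-grained.S01**, `SETH ↔ s_∞ = 1`) — and reduces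
**fine-grained.S04** "assuming ETH, `(s_k)` increases infinitely often"
(`ETH.frequently_satExponent_lt`) to Impagliazzo–Paturi's Theorem 3 alone
(`ETH.frequently_satExponent_lt_of_satExponent_le_satExponentLimit`).

## References

* R. Impagliazzo, R. Paturi, *On the complexity of k-SAT*, J. Comput. System Sci. 62 (2001)
  367–375, doi:10.1006/jcss.2000.1727, §1, p. 368 (definition of `s_k`; the bound `s_k ≤ 1`
  is implicit), p. 374 (proof of Theorem 3, step 1: exhaustive search). [ImpagliazzoPaturiJCSS2001]
* S. Arora, B. Barak, *Computational Complexity: A Modern Approach*, CUP 2009, §1.3–1.4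
  (machine constructions, clocked simulation).
-/

namespace Literature.Computability.FineGrained.BruteForce

open Complexity Complexity.TM2Iter _root_.Computability Turing

variable {k : ℕ}

/-! ### Small list lemmas -/

/-- `any` depends only on the values of the predicate on the members. [folklore] -/
theorem any_congr_mem {α : Type} (c : List α) {p q : α → Bool} (h : ∀ l ∈ c, p l = q l) :
    c.any p = c.any q := by
  induction c with
  | nil => rfl
  | cons a c ih =>
    rw [List.any_cons, List.any_cons, h a (by simp), ih fun l hl => h l (by simp [hl])]

/-- `all (any ·)` depends only on the values of the predicate on the members of members.
[folklore] -/
theorem all_any_congr_mem {α : Type} (cs : List (List α)) {p q : α → Bool}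
    (h : ∀ c ∈ cs, ∀ l ∈ c, p l = q l) :
    (cs.all fun c => c.any p) = (cs.all fun c => c.any q) := by
  induction cs with
  | nil => rfl
  | cons c cs ih =>
    rw [List.all_cons, List.all_cons, any_congr_mem c (h c (by simp)),
      ih fun c' hc' => h c' (by simp [hc'])]

/-! ### The formula as tokens; pivots, ranks, skeleton -/

/-- The tokens of a clause: `bra`, the literals `(encodeNat index, polarity)`, `ket`. [folklore] -/
def clauseToks (c : List (ℕ × Bool)) : List OTok :=
  OTok.br false :: ((c.map fun l => OTok.lit (encodeNat l.1) l.2) ++ [OTok.br true])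

/-- The tokens of a formula. [folklore] -/
def toks (φ : KCNF k) : List OTok := φ.clauses.flatMap clauseToks

/-- The pivots of a formula: its distinct occurring variable indices (as bit strings), in order
of first occurrence. [folklore] -/
def pivs (φ : KCNF k) : List (List Bool) := pivots (litBits (toks φ))

/-- `v`: the number of distinct occurring variables. [folklore] -/
def nv (φ : KCNF k) : ℕ := (pivs φ).length

/-- The rank of a variable index: its position among the pivots. [folklore] -/
def rank (φ : KCNF k) (i : ℕ) : ℕ := (pivs φ).idxOf (encodeNat i)

/-- The skeleton of a formula: its clauses with variables replaced by ranks. [folklore] -/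
def skel (φ : KCNF k) : Skeleton := φ.clauses.map fun c => c.map fun l => (rank φ l.1, l.2)

/-- `canon` of no token. [folklore] -/
theorem canon_nil (P : List (List Bool)) : canon P [] = [] := rfl

/-- `canon` token by token. [folklore] -/
theorem canon_cons (P : List (List Bool)) (t : OTok) (ts : List OTok) :
    canon P (t :: ts) = litTok (canonLit P) t :: canon P ts := rfl

/-- `canon` is a monoid morphism. [folklore] -/
theorem canon_append (P : List (List Bool)) (ts ts' : List OTok) :
    canon P (ts ++ ts') = canon P ts ++ canon P ts' :=
  List.map_append

/-- `litBits` of the tokens of a clause: the encoded indices of its literals. [folklore] -/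
theorem litBits_clauseToks (c : List (ℕ × Bool)) :
    litBits (clauseToks c) = c.map fun l => encodeNat l.1 := by
  rw [clauseToks, litBits_cons_br, litBits_append]
  induction c with
  | nil => rfl
  | cons l c ih =>
    rw [List.map_cons, litBits_cons_lit, List.map_cons]
    simpa using ih

/-- `litBits` of the tokens of a formula. [folklore] -/
theorem litBits_toks (φ : KCNF k) :
    litBits (toks φ) = φ.clauses.flatMap fun c => c.map fun l => encodeNat l.1 := by
  unfold toks
  induction φ.clauses with
  | nil => rfl
  | cons c cs ih => rw [List.flatMap_cons, litBits_append, litBits_clauseToks, ih, List.flatMap_cons]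

/-- The encoded index of an occurring literal is a pivot. [folklore] -/
theorem encodeNat_mem_pivs (φ : KCNF k) {c : List (ℕ × Bool)} (hc : c ∈ φ.clauses) {l : ℕ × Bool}
    (hl : l ∈ c) : encodeNat l.1 ∈ pivs φ := by
  rw [pivs, mem_pivots_iff, litBits_toks, List.mem_flatMap]
  exact ⟨c, hc, List.mem_map.2 ⟨l, hl, rfl⟩⟩

/-- Hence its rank is `< v`. [folklore] -/
theorem rank_lt_nv (φ : KCNF k) {c : List (ℕ × Bool)} (hc : c ∈ φ.clauses) {l : ℕ × Bool}
    (hl : l ∈ c) : rank φ l.1 < nv φ :=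
  List.idxOf_lt_length_iff.2 (encodeNat_mem_pivs φ hc hl)

/-- The skeleton is well formed for width `v`. [folklore] -/
theorem wf_skel (φ : KCNF k) : WF (nv φ) (skel φ) := by
  intro c' hc' l' hl'
  simp only [skel, List.mem_map] at hc'
  obtain ⟨c, hc, rfl⟩ := hc'
  obtain ⟨l, hl, rfl⟩ := List.mem_map.1 hl'
  exact rank_lt_nv φ hc hl

/-- `v ≤ numVars`: the pivots are encodings of indices `< numVars`. [folklore] -/
theorem nv_le_numVars (φ : KCNF k) : nv φ ≤ φ.numVars := by
  rw [nv, pivs, length_pivots]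
  calc (litBits (toks φ)).toFinset.card
      ≤ ((Finset.range φ.numVars).image encodeNat).card := by
        apply Finset.card_le_card
        intro b hb
        rw [List.mem_toFinset, litBits_toks, List.mem_flatMap] at hb
        obtain ⟨c, hc, hb⟩ := hb
        obtain ⟨l, hl, rfl⟩ := List.mem_map.1 hb
        exact Finset.mem_image.2 ⟨l.1, Finset.mem_range.2 (φ.fst_lt_numVars c hc l hl), rfl⟩
    _ ≤ (Finset.range φ.numVars).card := Finset.card_image_le
    _ = φ.numVars := Finset.card_range _

/-- `v` is at most the number of literal occurrences. [folklore] -/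
theorem nv_le_length_litBits (φ : KCNF k) : nv φ ≤ (litBits (toks φ)).length := by
  rw [nv, pivs, length_pivots]
  exact List.toFinset_card_le _

/-! ### Semantics: the skeleton is satisfiable iff the formula is -/

/-- The value of the skeleton under `bs` is the value of the formula under the assignment
"variable `i` ↦ bit `rank i` of `bs`". [folklore] -/
theorem formVal_skel (φ : KCNF k) (bs : List Bool) :
    formVal bs (skel φ) = φ.eval fun i => bs.getD (rank φ i) false := by
  simp [formVal, skel, KCNF.eval, clauseVal, litVal, List.all_map, List.any_map, Function.comp_def]

/-- The value of a formula depends only on the values of the occurring variables. [folklore] -/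
theorem _root_.Literature.Computability.FineGrained.KCNF.eval_congr (φ : KCNF k) {w w' : ℕ → Bool}
    (h : ∀ c ∈ φ.clauses, ∀ l ∈ c, w l.1 = w' l.1) : φ.eval w = φ.eval w' :=
  all_any_congr_mem φ.clauses fun c hc l hl => by rw [h c hc l hl]

/-- **The skeleton is satisfiable by an assignment of its `v` ranked variables iff the formula
is satisfiable.** [folklore] -/
theorem exists_formVal_skel_iff (φ : KCNF k) :
    (∃ bs : List Bool, bs.length = nv φ ∧ formVal bs (skel φ) = true) ↔ φ.Satisfiable := by
  constructor
  · rintro ⟨bs, -, hbs⟩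
    rw [formVal_skel] at hbs
    refine ⟨fun i => bs.getD (rank φ i) false, ?_⟩
    rw [← hbs]
    apply KCNF.eval_congr
    intro c hc l hl
    simp [φ.fst_lt_numVars c hc l hl]
  · rintro ⟨v₀, hv₀⟩
    generalize hW : (fun i => if h : i < φ.numVars then v₀ ⟨i, h⟩ else false) = W at hv₀
    refine ⟨(pivs φ).map fun b => W (decodeNat b), by simp [nv], ?_⟩
    rw [formVal_skel, ← hv₀]
    apply KCNF.eval_congr
    intro c hc l hl
    have hmem := encodeNat_mem_pivs φ hc hl
    have hlt : (pivs φ).idxOf (encodeNat l.1) < (pivs φ).length := List.idxOf_lt_length_iff.2 hmem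
    unfold rank
    rw [List.getD_eq_getElem _ _ (by simpa using hlt), List.getElem_map, List.getElem_idxOf hlt,
      decode_encodeNat]

/-! ### Stage 1: the input transducer -/

/-- States of the input transducer: inside the `numVars` prefix, between literals, inside a
literal of polarity `pol`. [folklore] -/
inductive ISt | pre | body | lit (pol : Bool)
  deriving DecidableEq, Fintype

/-- Transition function of the input transducer: two clock ticks per input symbol; the
`numVars` prefix is dropped, brackets are copied, a literal `pol, index bits, comma` becomes
`index bits (unchecked), head U pol`. [folklore] -/
def inStep : ISt → Γ' → ISt × List (Option RSym)
  | .pre, .comma => (.body, [none, none])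
  | .pre, _ => (.pre, [none, none])
  | .body, .bra => (.body, [none, none, some .bra])
  | .body, .ket => (.body, [none, none, some .ket])
  | .body, .bit b => (.lit b, [none, none])
  | .body, _ => (.body, [none, none])
  | .lit p, .bit b => (.lit p, [none, none, some (.ibit false b)])
  | .lit p, .comma => (.body, [none, none, some (.head .U p)])
  | .lit p, _ => (.lit p, [none, none])

/-- **The input transducer**; its `front` is the mode symbol and the unit seed of the renaming
stage. [folklore] -/
def inFST : FST ISt Γ' (Option RSym) where
  init := .pre
  step := inStep
  front _ := [some (.mode .sel), some .unit]
  keep _ := true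

/-- Every transition emits at most three symbols. [folklore] -/
theorem inStep_length_le (s : ISt) (x : Γ') : (inStep s x).2.length ≤ 3 := by
  cases s <;> cases x <;> simp [inStep]

/-- `maxEmit inFST ≤ 3`. [folklore] -/
theorem inFST_maxEmit_le : inFST.maxEmit ≤ 3 :=
  Finset.sup_le fun p _ => inStep_length_le p.1 p.2

/-- `maxFront inFST ≤ 2`. [folklore] -/
theorem inFST_maxFront_le : inFST.maxFront ≤ 2 :=
  Finset.sup_le fun _ _ => le_rfl

/-- Output of the input transducer on a literal. [folklore] -/
def litOut (l : ℕ × Bool) : List (Option RSym) :=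
  [none, none] ++ ((encodeNat l.1).flatMap fun b => [none, none, some (.ibit false b)]) ++
    [none, none, some (.head .U l.2)]

/-- Output of the input transducer on a clause. [folklore] -/
def clauseOut (c : List (ℕ × Bool)) : List (Option RSym) :=
  [none, none, some .bra] ++ c.flatMap litOut ++ [none, none, some .ket]

section InRun


/-- The transducer's step is `inStep`. [folklore] -/
theorem inFST_step (s : ISt) (x : Γ') : inFST.step s x = inStep s x := rfl

/-- The transducer starts in `pre`. [folklore] -/
theorem inFST_init : inFST.init = ISt.pre := rfl

/-- Inside a literal: index bits are copied unchecked, two ticks each. [folklore] -/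
theorem run_lit_bits (p : Bool) (bs : List Bool) (rest : List Γ') :
    inFST.run (.lit p) (bs.map Γ'.bit ++ rest) =
      ((inFST.run (.lit p) rest).1,
        (bs.flatMap fun b => [none, none, some (.ibit false b)]) ++ (inFST.run (.lit p) rest).2) := by
  induction bs with
  | nil => simp
  | cons b bs ih => simp [FST.run_cons, inFST_step, inStep, ih]

/-- A literal. [folklore] -/
theorem run_body_encodeLiteral (l : ℕ × Bool) (rest : List Γ') :
    inFST.run .body (KCNF.encodeLiteral l ++ rest) = ((inFST.run .body rest).1, litOut l ++ (inFST.run .body rest).2) := by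
  have e : KCNF.encodeLiteral l ++ rest = Γ'.bit l.2 :: ((encodeNat l.1).map Γ'.bit ++ (Γ'.comma :: rest)) := by
    simp [KCNF.encodeLiteral]
  rw [e, FST.run_cons, inFST_step]
  simp only [inStep]
  rw [run_lit_bits, FST.run_cons, inFST_step]
  simp [inStep, litOut]

/-- The literals of a clause. [folklore] -/
theorem run_body_literals (c : List (ℕ × Bool)) (rest : List Γ') :
    inFST.run .body (c.flatMap KCNF.encodeLiteral ++ rest) =
      ((inFST.run .body rest).1, c.flatMap litOut ++ (inFST.run .body rest).2) := by
  induction c with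
  | nil => simp
  | cons l c ih => rw [List.flatMap_cons, List.append_assoc, run_body_encodeLiteral, ih]; simp

/-- A clause. [folklore] -/
theorem run_body_encodeClause (c : List (ℕ × Bool)) (rest : List Γ') :
    inFST.run .body (KCNF.encodeClause c ++ rest) = ((inFST.run .body rest).1, clauseOut c ++ (inFST.run .body rest).2) := by
  have e : KCNF.encodeClause c ++ rest = Γ'.bra :: (c.flatMap KCNF.encodeLiteral ++ (Γ'.ket :: rest)) := by
    simp [KCNF.encodeClause]
  rw [e, FST.run_cons, inFST_step]
  simp only [inStep]
  rw [run_body_literals, FST.run_cons, inFST_step]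
  simp [inStep, clauseOut]

/-- The clauses. [folklore] -/
theorem run_body_clauses (cs : List (List (ℕ × Bool))) :
    inFST.run .body (cs.flatMap KCNF.encodeClause) = (.body, cs.flatMap clauseOut) := by
  induction cs with
  | nil => simp
  | cons c cs ih => rw [List.flatMap_cons, run_body_encodeClause, ih]; simp

/-- The `numVars` prefix: two ticks per symbol, nothing else. [folklore] -/
theorem run_pre (bs : List Bool) (rest : List Γ') :
    inFST.run .pre (bs.map Γ'.bit ++ Γ'.comma :: rest) =
      ((inFST.run .body rest).1, (bs.flatMap fun _ => [none, none]) ++ [none, none] ++ (inFST.run .body rest).2) := by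
  induction bs with
  | nil => simp [FST.run_cons, inFST_step, inStep]
  | cons b bs ih => simp [FST.run_cons, inFST_step, inStep, ih]

end InRun

/-- **The input transducer on an encoded formula.** [folklore] -/
theorem inFST_eval (φ : KCNF k) :
    inFST.eval φ.encode =
      [some (.mode .sel), some .unit] ++
        (((encodeNat φ.numVars).flatMap fun _ => [none, none]) ++ [none, none] ++
          φ.clauses.flatMap clauseOut) := by
  rw [FST.eval, inFST_init, KCNF.encode, run_pre, run_body_clauses]
  simp [inFST]

/-- Ticks of a literal's output: two per input symbol. [folklore] -/
theorem countP_isNone_litOut (l : ℕ × Bool) :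
    (litOut l).countP Option.isNone = 2 * (KCNF.encodeLiteral l).length := by
  simp only [litOut, List.countP_append, countP_isNone_flatMap, KCNF.encodeLiteral, List.length_cons,
    List.length_append, List.length_map]
  simp [List.map_const', List.sum_replicate]
  omega

/-- Data of a literal's output: the initial literal of the renaming stage. [folklore] -/
theorem reduceOption_litOut (l : ℕ × Bool) :
    (litOut l).reduceOption = encTok (litTok (canonLit []) (OTok.lit (encodeNat l.1) l.2)) := by
  simp only [litOut, List.reduceOption_append, List.reduceOption_cons_of_none,
    List.reduceOption_cons_of_some, List.reduceOption_nil, reduceOption_flatMap, litTok_lit, encTok,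
    encLit, canonLit, canonCells]
  simp [markBits_zero, ← List.map_eq_flatMap]

/-- Ticks of a clause's output. [folklore] -/
theorem countP_isNone_clauseOut (c : List (ℕ × Bool)) :
    (clauseOut c).countP Option.isNone = 2 * (KCNF.encodeClause c).length := by
  simp only [clauseOut, List.countP_append, countP_isNone_flatMap, KCNF.encodeClause, List.length_cons,
    List.length_append, List.length_flatMap]
  have : (c.map fun l => (litOut l).countP Option.isNone) = c.map fun l => 2 * (KCNF.encodeLiteral l).length :=
    List.map_congr_left fun l _ => countP_isNone_litOut l
  rw [this, List.sum_map_mul_left]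
  simp
  omega

/-- Data of the literals' outputs. [folklore] -/
theorem reduceOption_flatMap_litOut (c : List (ℕ × Bool)) :
    (c.flatMap litOut).reduceOption = encBody (canon [] (c.map fun l => OTok.lit (encodeNat l.1) l.2)) := by
  induction c with
  | nil => simp [canon_nil]
  | cons l c ih =>
    rw [List.flatMap_cons, List.reduceOption_append, reduceOption_litOut, ih, List.map_cons, canon_cons, encBody_cons]

/-- Data of a clause's output: the initial clause of the renaming stage. [folklore] -/
theorem reduceOption_clauseOut (c : List (ℕ × Bool)) :
    (clauseOut c).reduceOption = encBody (canon [] (clauseToks c)) := by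
  rw [clauseOut, List.reduceOption_append, List.reduceOption_append, reduceOption_flatMap_litOut, clauseToks, canon_cons, canon_append,
    encBody_cons, encBody_append]
  simp [encTok, canon_cons, canon_nil, encBody_cons]

/-- Data of the clauses' outputs. [folklore] -/
theorem reduceOption_flatMap_clauseOut (cs : List (List (ℕ × Bool))) :
    (cs.flatMap clauseOut).reduceOption = encBody (canon [] (cs.flatMap clauseToks)) := by
  induction cs with
  | nil => simp [canon_nil]
  | cons c cs ih =>
    rw [List.flatMap_cons, List.reduceOption_append, reduceOption_clauseOut, ih, List.flatMap_cons, canon_append,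
      encBody_append]

/-- Ticks of the clauses' outputs. [folklore] -/
theorem countP_isNone_flatMap_clauseOut (cs : List (List (ℕ × Bool))) :
    (cs.flatMap clauseOut).countP Option.isNone = 2 * (cs.flatMap KCNF.encodeClause).length := by
  induction cs with
  | nil => simp
  | cons c cs ih =>
    rw [List.flatMap_cons, List.countP_append, countP_isNone_clauseOut, ih, List.flatMap_cons, List.length_append]
    ring

/-- Length of an encoded formula. [folklore] -/
theorem length_encode (φ : KCNF k) :
    φ.encode.length =
      (encodeNat φ.numVars).length + 1 + (φ.clauses.flatMap KCNF.encodeClause).length := by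
  simp only [KCNF.encode, List.length_append, List.length_map, List.length_cons]
  omega

/-- **The input stage emits `2L` ticks.** [folklore] -/
theorem countP_isNone_inFST_eval (φ : KCNF k) : (inFST.eval φ.encode).countP Option.isNone = 2 * φ.encode.length := by
  rw [inFST_eval, List.countP_append, List.countP_append, List.countP_append, countP_isNone_flatMap_clauseOut, countP_isNone_flatMap,
    List.map_const', List.sum_replicate, smul_eq_mul, length_encode]
  simp
  ring

/-- **The input stage lays out the initial state of the renaming stage.** [folklore] -/
theorem reduceOption_inFST_eval (φ : KCNF k) :
    (inFST.eval φ.encode).reduceOption = encState .sel 1 (initBody (toks φ)) := by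
  rw [inFST_eval, List.reduceOption_append, List.reduceOption_append, List.reduceOption_append, reduceOption_flatMap_clauseOut, reduceOption_flatMap,
    encState, initBody, toks]
  simp

/-- The output of the input stage has length `≤ 3L + 2`. [folklore] -/
theorem length_inFST_eval_le (φ : KCNF k) : (inFST.eval φ.encode).length ≤ 3 * φ.encode.length + 2 := by
  have h := inFST.length_eval_le φ.encode
  have h1 := Nat.mul_le_mul_right φ.encode.length inFST_maxEmit_le
  have h2 := inFST_maxFront_le
  omega

/-! ### Stage 3: from ranked literals to counter cells -/

/-- The counter cell of a renaming cell: marked iff `mark`; all bits `0`. [folklore] -/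
def cellSym : CellKind → CSym
  | .mark => .cell true false
  | _ => .cell false false

/-- Output of the third stage on a symbol: units become ticks, index bits disappear, cells
become counter cells, heads keep their polarity, the mode becomes `run false`. [folklore] -/
def faOut : RSym → List (Option CSym)
  | .mode _ => [some (.mode false false)]
  | .unit => [none]
  | .bra => [some .bra]
  | .ket => [some .ket]
  | .ibit _ _ => []
  | .cell c => [some (cellSym c)]
  | .head _ pol => [some (.head pol)]

/-- **The third stage**, a stateless transducer. [folklore] -/
def faFST : FST Unit RSym (Option CSym) where
  init := ()
  step _ x := ((), faOut x)
  front _ := []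
  keep _ := true

/-- `maxEmit faFST ≤ 1`. [folklore] -/
theorem faFST_maxEmit_le : faFST.maxEmit ≤ 1 :=
  Finset.sup_le fun p _ => by
    rcases p with ⟨_, x⟩
    cases x <;> simp [faFST, faOut]

/-- `maxFront faFST = 0`. [folklore] -/
theorem faFST_maxFront_le : faFST.maxFront ≤ 0 :=
  Finset.sup_le fun _ _ => le_rfl

/-- A stateless transducer is a `flatMap`. [folklore] -/
theorem faFST_run (l : List RSym) : faFST.run () l = ((), l.flatMap faOut) := by
  induction l with
  | nil => rfl
  | cons x l ih =>
    rw [FST.run_cons, List.flatMap_cons]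
    change ((faFST.run () l).1, faOut x ++ (faFST.run () l).2) = _
    rw [ih]

/-- The third stage is the `flatMap` of `faOut`. [folklore] -/
theorem faFST_eval (l : List RSym) : faFST.eval l = l.flatMap faOut := by
  rw [FST.eval]
  change faFST.front (faFST.run () l).1 ++ _ = _
  rw [faFST_run]
  simp [faFST]

/-- Units become ticks. [folklore] -/
theorem flatMap_faOut_replicate_unit (u : ℕ) :
    (List.replicate u RSym.unit).flatMap faOut = List.replicate u none := by
  induction u with
  | zero => rfl
  | succ u ih => rw [List.replicate_succ, List.flatMap_cons, ih]; rfl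

/-- Index bits disappear. [folklore] -/
theorem flatMap_faOut_markBits_zero (bs : List Bool) : (markBits 0 bs).flatMap faOut = [] := by
  rw [markBits_zero]
  induction bs with
  | nil => rfl
  | cons b bs ih => simpa [faOut] using ih

/-- The cells of rank `j < v` over the all-zero counter. [folklore] -/
theorem cells_replicate_false {j v : ℕ} (hj : j < v) :
    cells j (List.replicate v false) =
      List.replicate j (.cell false false) ++ .cell true false :: List.replicate (v - 1 - j) (.cell false false) := by
  induction j generalizing v with
  | zero =>
    obtain ⟨v, rfl⟩ : ∃ v', v = v' + 1 := ⟨v - 1, by omega⟩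
    rw [List.replicate_succ, cells_zero_cons, List.map_replicate]
    simp
  | succ j ih =>
    obtain ⟨v, rfl⟩ : ∃ v', v = v' + 1 := ⟨v - 1, by omega⟩
    rw [List.replicate_succ, cells_succ_cons, ih (by omega), List.replicate_succ, List.cons_append]
    have e : v + 1 - 1 - (j + 1) = v - 1 - j := by omega
    rw [e]

/-- The canonical cells of a pivot become the counter cells of its rank. [folklore] -/
theorem map_cellSym_canonCells {P : List (List Bool)} {b : List Bool} (hb : b ∈ P) :
    (canonCells P b).map cellSym = cells (P.idxOf b) (List.replicate P.length false) := by
  rw [canonCells, if_pos hb, cells_replicate_false (List.idxOf_lt_length_iff.2 hb)]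
  simp [List.map_replicate, cellSym]

/-- The third stage on a ranked literal: no tick; its counter cells and head. [folklore] -/
theorem flatMap_faOut_encLit {P : List (List Bool)} {b : List Bool} (hb : b ∈ P) (pol : Bool) :
    (encLit (canonLit P b pol)).flatMap faOut =
      (litEnc (List.replicate P.length false) (P.idxOf b, pol)).map some := by
  rw [encLit, List.flatMap_append, List.flatMap_append]
  simp only [canonLit]
  rw [flatMap_faOut_markBits_zero, List.nil_append, litEnc, ← map_cellSym_canonCells hb,
    List.flatMap_map]
  simp [faOut, ← List.map_eq_flatMap]

/-- The third stage on the ranked literals of a clause. [folklore] -/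
theorem flatMap_faOut_lits (P : List (List Bool)) (c : List (ℕ × Bool))
    (hc : ∀ l ∈ c, encodeNat l.1 ∈ P) :
    (encBody (canon P (c.map fun l => OTok.lit (encodeNat l.1) l.2))).flatMap faOut =
      ((c.map fun l => (P.idxOf (encodeNat l.1), l.2)).flatMap
        (litEnc (List.replicate P.length false))).map some := by
  induction c with
  | nil => simp [canon_nil]
  | cons l c ih =>
    have ih := ih fun l' hl' => hc l' (by simp [hl'])
    rw [List.map_cons, canon_cons, encBody_cons, List.flatMap_append, ih, litTok_lit, encTok,
      flatMap_faOut_encLit (hc l (by simp)), List.map_cons, List.flatMap_cons, List.map_append]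

/-- The third stage on the ranked body of a clause. [folklore] -/
theorem flatMap_faOut_clause (P : List (List Bool)) (c : List (ℕ × Bool))
    (hc : ∀ l ∈ c, encodeNat l.1 ∈ P) :
    (encBody (canon P (clauseToks c))).flatMap faOut =
      (clauseEnc (List.replicate P.length false) (c.map fun l => (P.idxOf (encodeNat l.1), l.2))).map
        some := by
  rw [clauseToks, canon_cons, canon_append, encBody_cons, encBody_append, List.flatMap_append,
    List.flatMap_append, flatMap_faOut_lits P c hc]
  simp [encTok, faOut, clauseEnc, canon_cons, canon_nil, encBody_cons]

/-- The third stage on the ranked body of the clauses. [folklore] -/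
theorem flatMap_faOut_clauses (P : List (List Bool)) (cs : List (List (ℕ × Bool)))
    (hcs : ∀ c ∈ cs, ∀ l ∈ c, encodeNat l.1 ∈ P) :
    (encBody (canon P (cs.flatMap clauseToks))).flatMap faOut =
      (bodyEnc (List.replicate P.length false)
        (cs.map fun c => c.map fun l => (P.idxOf (encodeNat l.1), l.2))).map some := by
  induction cs with
  | nil => simp [canon_nil]
  | cons c cs ih =>
    have ih := ih fun c' hc' => hcs c' (by simp [hc'])
    rw [List.flatMap_cons, canon_append, encBody_append, List.flatMap_append, ih,
      flatMap_faOut_clause P c (hcs c (by simp)), List.map_cons, bodyEnc_cons, List.map_append]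

/-- **The third stage on the final state of the renaming stage**: `2^v` ticks, then the
initial state of the counting stage. [folklore] -/
theorem faFST_eval_finalState (φ : KCNF k) :
    faFST.eval (finalState (toks φ)) =
      some (CSym.mode false false) :: (List.replicate (2 ^ nv φ) none ++
        (bodyEnc (List.replicate (nv φ) false) (skel φ)).map some) := by
  have hfs : finalState (toks φ) = encState .fin (2 ^ nv φ) (canon (pivs φ) (toks φ)) := rfl
  rw [faFST_eval, hfs, encState, List.flatMap_cons, List.flatMap_append,
    flatMap_faOut_replicate_unit, toks,
    flatMap_faOut_clauses (pivs φ) φ.clauses (fun c hc l hl => encodeNat_mem_pivs φ hc hl)]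
  rfl

/-- **The third stage emits `2^v` ticks.** [folklore] -/
theorem countP_isNone_faFST_eval (φ : KCNF k) :
    (faFST.eval (finalState (toks φ))).countP Option.isNone = 2 ^ nv φ := by
  rw [faFST_eval_finalState]; simp [List.countP_replicate, Function.comp_def]

/-- **The third stage lays out the initial state of the counting stage.** [folklore] -/
theorem reduceOption_faFST_eval (φ : KCNF k) :
    (faFST.eval (finalState (toks φ))).reduceOption =
      runState false (List.replicate (nv φ) false) (skel φ) := by
  rw [faFST_eval_finalState]; simp [runState, List.reduceOption_append]

/-- The third stage does not lengthen its input. [folklore] -/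
theorem length_faFST_eval_le (l : List RSym) : (faFST.eval l).length ≤ l.length := by
  have h := faFST.length_eval_le l
  have h1 := Nat.mul_le_mul_right l.length faFST_maxEmit_le
  have h2 := faFST_maxFront_le
  omega

/-! ### Stage 5: the answer bit -/

/-- Output of the last stage on a symbol: the flag of a mode symbol. [folklore] -/
def outStep : CSym → List Bool
  | .mode _ f => [f]
  | _ => []

/-- **The last stage**, a stateless transducer. [folklore] -/
def outFST : FST Unit CSym Bool where
  init := ()
  step _ x := ((), outStep x)
  front _ := []
  keep _ := true

/-- `maxEmit outFST ≤ 1`. [folklore] -/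
theorem outFST_maxEmit_le : outFST.maxEmit ≤ 1 :=
  Finset.sup_le fun p _ => by
    rcases p with ⟨_, x⟩
    cases x <;> simp [outFST, outStep]

/-- The last stage on the final state of the counting stage. [folklore] -/
theorem outFST_eval_mode (d f : Bool) : outFST.eval [.mode d f] = [f] := by
  simp [FST.eval, outFST, outStep]

/-! ### Size bounds -/

/-- Length of an encoded clause, literal by literal. [folklore] -/
theorem length_encodeClause_cons (l : ℕ × Bool) (c : List (ℕ × Bool)) :
    (KCNF.encodeClause (l :: c)).length = (encodeNat l.1).length + 2 + (KCNF.encodeClause c).length := by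
  simp [KCNF.encodeClause, KCNF.encodeLiteral]
  omega

/-- Length of the encoded empty clause. [folklore] -/
theorem length_encodeClause_nil : (KCNF.encodeClause ([] : List (ℕ × Bool))).length = 2 := rfl

/-- The pass count of the renaming stage against the encoding. [folklore] -/
theorem sum_litBits_le (cs : List (List (ℕ × Bool))) :
    ((cs.flatMap fun c => c.map fun l => encodeNat l.1).map fun b => b.length + 3).sum ≤
      2 * (cs.flatMap KCNF.encodeClause).length := by
  induction cs with
  | nil => simp
  | cons c cs ih =>
    rw [List.flatMap_cons, List.flatMap_cons, List.map_append, List.sum_append, List.length_append]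
    have hc : ((c.map fun l => encodeNat l.1).map fun b => b.length + 3).sum ≤
        2 * (KCNF.encodeClause c).length := by
      induction c with
      | nil => simp
      | cons l c ihc => rw [List.map_cons, List.map_cons, List.sum_cons, length_encodeClause_cons]; omega
    omega

/-- **`2L` passes suffice for the renaming stage.** [folklore] -/
theorem rankPasses_le_two_mul (φ : KCNF k) : rankPasses (litBits (toks φ)) ≤ 2 * φ.encode.length := by
  refine (rankPasses_le _).trans ?_
  rw [litBits_toks, length_encode]
  have := sum_litBits_le φ.clauses
  omega

/-- The number of literal occurrences is at most `L`. [folklore] -/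
theorem length_litBits_le (φ : KCNF k) : (litBits (toks φ)).length ≤ φ.encode.length := by
  rw [litBits_toks, length_encode]
  have : ∀ cs : List (List (ℕ × Bool)),
      (cs.flatMap fun c => c.map fun l => encodeNat l.1).length ≤ (cs.flatMap KCNF.encodeClause).length := by
    intro cs
    induction cs with
    | nil => simp
    | cons c cs ih =>
      rw [List.flatMap_cons, List.flatMap_cons, List.length_append, List.length_append, List.length_map]
      have hc : c.length ≤ (KCNF.encodeClause c).length := by
        induction c with
        | nil => simp
        | cons l c ihc => rw [List.length_cons, length_encodeClause_cons]; omega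
      omega
  have := this φ.clauses
  omega

/-- `v ≤ L`. [folklore] -/
theorem nv_le_length (φ : KCNF k) : nv φ ≤ φ.encode.length :=
  (nv_le_length_litBits φ).trans (length_litBits_le φ)

/-- The canonical body for `v` pivots against the encoding. [folklore] -/
theorem sum_tokLen_le (v : ℕ) (cs : List (List (ℕ × Bool))) :
    ((cs.flatMap clauseToks).map (tokLen v)).sum ≤ (v + 1) * (cs.flatMap KCNF.encodeClause).length := by
  induction cs with
  | nil => simp
  | cons c cs ih =>
    rw [List.flatMap_cons, List.flatMap_cons, List.map_append, List.sum_append, List.length_append,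
      Nat.mul_add]
    have hc : ((clauseToks c).map (tokLen v)).sum ≤ (v + 1) * (KCNF.encodeClause c).length := by
      rw [clauseToks, List.map_cons, List.map_append, List.sum_cons, List.sum_append]
      have hlits : ∀ c : List (ℕ × Bool),
          ((c.map fun l => OTok.lit (encodeNat l.1) l.2).map (tokLen v)).sum + 2 * (v + 1) ≤
            (v + 1) * (KCNF.encodeClause c).length := by
        intro c
        induction c with
        | nil => simp [length_encodeClause_nil]; omega
        | cons l c ihc =>
          rw [List.map_cons, List.map_cons, List.sum_cons, length_encodeClause_cons]
          have e : (v + 1) * ((encodeNat l.1).length + 2 + (KCNF.encodeClause c).length) =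
              v * (encodeNat l.1).length + (encodeNat l.1).length + 2 * v + 2 +
                (v + 1) * (KCNF.encodeClause c).length := by ring
          rw [e]
          simp only [tokLen]
          omega
      have := hlits c
      simp only [tokLen, List.map_cons, List.map_nil, List.sum_cons, List.sum_nil]
      omega
    omega

/-- **Size bound of the renaming stage**: the final state (hence every intermediate state) has
length `≤ 2ⁿ + (L + 1)²`. [folklore] -/
theorem length_finalState_le (φ : KCNF k) :
    (finalState (toks φ)).length ≤ 2 ^ φ.numVars + (φ.encode.length + 1) ^ 2 := by
  rw [length_finalState]
  have hP : (pivots (litBits (toks φ))).length = nv φ := rfl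
  rw [hP]
  have h1 : 2 ^ nv φ ≤ 2 ^ φ.numVars := Nat.pow_le_pow_right (by norm_num) (nv_le_numVars φ)
  have h2 : ((toks φ).map (tokLen (nv φ))).sum ≤ (nv φ + 1) * (φ.clauses.flatMap KCNF.encodeClause).length :=
    sum_tokLen_le (nv φ) φ.clauses
  have h3 : nv φ ≤ φ.encode.length := nv_le_length φ
  have hL := length_encode φ
  have h4 : (nv φ + 1) * (φ.clauses.flatMap KCNF.encodeClause).length ≤
      (φ.encode.length + 1) * (φ.clauses.flatMap KCNF.encodeClause).length :=
    Nat.mul_le_mul_right _ (by omega)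
  have h5 : (φ.encode.length + 1) * ((φ.clauses.flatMap KCNF.encodeClause).length + 1) ≤
      (φ.encode.length + 1) * φ.encode.length := Nat.mul_le_mul_left _ (by omega)
  have e1 : (φ.encode.length + 1) * ((φ.clauses.flatMap KCNF.encodeClause).length + 1) =
      (φ.encode.length + 1) * (φ.clauses.flatMap KCNF.encodeClause).length + (φ.encode.length + 1) := by
    ring
  have e2 : (φ.encode.length + 1) ^ 2 = (φ.encode.length + 1) * φ.encode.length + (φ.encode.length + 1) := by
    ring
  omega

/-- Length of an encoded clause of the counting stage, literal by literal. [folklore] -/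
theorem length_clauseEnc_cons (bs : List Bool) (l : ℕ × Bool) (c : List (ℕ × Bool)) :
    (clauseEnc bs (l :: c)).length = bs.length + 1 + (clauseEnc bs c).length := by
  simp [clauseEnc, litEnc]
  omega

/-- Length of the running state of the counting stage against the encoding. [folklore] -/
theorem length_bodyEnc_le (bs : List Bool) (r : ℕ → ℕ) (cs : List (List (ℕ × Bool))) :
    (bodyEnc bs (cs.map fun c => c.map fun l => (r l.1, l.2))).length ≤
      (bs.length + 1) * (cs.flatMap KCNF.encodeClause).length := by
  induction cs with
  | nil => simp
  | cons c cs ih =>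
    rw [List.map_cons, bodyEnc_cons, List.length_append, List.flatMap_cons, List.length_append,
      Nat.mul_add]
    have hc : (clauseEnc bs (c.map fun l => (r l.1, l.2))).length ≤
        (bs.length + 1) * (KCNF.encodeClause c).length := by
      induction c with
      | nil => simp [clauseEnc, length_encodeClause_nil]
      | cons l c ihc =>
        rw [List.map_cons, length_clauseEnc_cons, length_encodeClause_cons]
        have e : (bs.length + 1) * ((encodeNat l.1).length + 2 + (KCNF.encodeClause c).length) =
            (bs.length + 1) * (encodeNat l.1).length + 2 * bs.length + 2 +
              (bs.length + 1) * (KCNF.encodeClause c).length := by ring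
        rw [e]
        omega
    omega

/-- **Size bound of the counting stage**: the running state has length `≤ (L + 1)²`.
[folklore] -/
theorem length_runState_le (φ : KCNF k) :
    (runState false (List.replicate (nv φ) false) (skel φ)).length ≤ (φ.encode.length + 1) ^ 2 := by
  rw [runState, List.length_cons, skel]
  have h1 := length_bodyEnc_le (List.replicate (nv φ) false) (rank φ) φ.clauses
  rw [List.length_replicate] at h1
  have h3 : nv φ ≤ φ.encode.length := nv_le_length φ
  have hL := length_encode φ
  have h4 : (nv φ + 1) * (φ.clauses.flatMap KCNF.encodeClause).length ≤
      (φ.encode.length + 1) * (φ.clauses.flatMap KCNF.encodeClause).length :=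
    Nat.mul_le_mul_right _ (by omega)
  have h5 : (φ.encode.length + 1) * ((φ.clauses.flatMap KCNF.encodeClause).length + 1) ≤
      (φ.encode.length + 1) * φ.encode.length := Nat.mul_le_mul_left _ (by omega)
  have e1 : (φ.encode.length + 1) * ((φ.clauses.flatMap KCNF.encodeClause).length + 1) =
      (φ.encode.length + 1) * (φ.clauses.flatMap KCNF.encodeClause).length + (φ.encode.length + 1) := by
    ring
  have e2 : (φ.encode.length + 1) ^ 2 = (φ.encode.length + 1) * φ.encode.length + (φ.encode.length + 1) := by
    ring
  omega

/-! ### Arithmetic of the time bound -/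

/-- The monomials of the stage bounds against `X · (L + 1)³` (`X ≥ 1`). [folklore] -/
theorem monomials_le {L X : ℕ} (hX : 1 ≤ X) :
    1 ≤ X * (L + 1) ^ 3 ∧ X ≤ X * (L + 1) ^ 3 ∧ L + 1 ≤ X * (L + 1) ^ 3 ∧
      (L + 1) ^ 2 ≤ X * (L + 1) ^ 3 ∧ (L + 1) ^ 3 ≤ X * (L + 1) ^ 3 ∧
        X * (L + 1) ≤ X * (L + 1) ^ 3 ∧ X * (L + 1) ^ 2 ≤ X * (L + 1) ^ 3 := by
  have hY : 1 ≤ L + 1 := Nat.succ_pos L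
  have p1 : L + 1 ≤ (L + 1) ^ 3 := Nat.le_self_pow (by norm_num) _
  have p2 : (L + 1) ^ 2 ≤ (L + 1) ^ 3 := Nat.pow_le_pow_right hY (by norm_num)
  have p3 : 1 ≤ (L + 1) ^ 3 := Nat.one_le_pow _ _ hY
  have q : (L + 1) ^ 3 ≤ X * (L + 1) ^ 3 := Nat.le_mul_of_pos_left _ hX
  have r : X * 1 ≤ X * (L + 1) ^ 3 := Nat.mul_le_mul_left X p3
  refine ⟨by omega, by omega, by omega, by omega, q, Nat.mul_le_mul_left X p1, Nat.mul_le_mul_left X p2⟩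

/-- Stage 1. [folklore] -/
theorem time₀_le {L X : ℕ} (hX : 1 ≤ X) : 4 * L + 3 ≤ 7 * (X * (L + 1) ^ 3) := by
  obtain ⟨m1, -, m3, -⟩ := monomials_le (L := L) hX
  omega

/-- Stage 2. [folklore] -/
theorem time₁_le {L X w B : ℕ} (hX : 1 ≤ X) (hw : w ≤ 3 * L + 2) (hB : B ≤ X + (L + 1) ^ 2) :
    w + B + 2 * L * (5 * B + 6) + 4 ≤ 43 * (X * (L + 1) ^ 3) := by
  obtain ⟨m1, m2, m3, m4, m5, m6, -⟩ := monomials_le (L := L) hX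
  have h2 : 2 * L * (5 * B + 6) ≤ 2 * (L + 1) * (5 * (X + (L + 1) ^ 2) + 6) :=
    Nat.mul_le_mul (by omega) (by omega)
  have h3 : 2 * (L + 1) * (5 * (X + (L + 1) ^ 2) + 6) =
      10 * (X * (L + 1)) + 10 * (L + 1) ^ 3 + 12 * (L + 1) := by ring
  omega

/-- Stage 3. [folklore] -/
theorem time₂_le {L X B : ℕ} (hX : 1 ≤ X) (hB : B ≤ X + (L + 1) ^ 2) :
    2 * B + 3 ≤ 7 * (X * (L + 1) ^ 3) := by
  obtain ⟨m1, m2, -, m4, -⟩ := monomials_le (L := L) hX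
  omega

/-- Stage 4. [folklore] -/
theorem time₃_le {L X w B t : ℕ} (hX : 1 ≤ X) (hw : w ≤ X + (L + 1) ^ 2) (hB : B ≤ (L + 1) ^ 2)
    (ht : t ≤ X) : w + B + t * (4 * B + 6) + 4 ≤ 17 * (X * (L + 1) ^ 3) := by
  obtain ⟨m1, m2, -, m4, -, -, m7⟩ := monomials_le (L := L) hX
  have h2 : t * (4 * B + 6) ≤ X * (4 * (L + 1) ^ 2 + 6) := Nat.mul_le_mul ht (by omega)
  have h3 : X * (4 * (L + 1) ^ 2 + 6) = 4 * (X * (L + 1) ^ 2) + 6 * X := by ring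
  omega

/-! ### The machine -/

/-- **Brute-force `k`-SAT on Mathlib's `TM2` model.** One multi-stack machine decides the
satisfiability of every `k`-CNF `φ` (every `k`), answering `[decide φ.Satisfiable]` on input
`φ.encode` within `79 · 2ⁿ · (L + 1)³` steps, `n = φ.numVars`, `L = |φ.encode|` (the exhaustive
search implicit in the definition of `s_k`, Impagliazzo–Paturi 2001, §1, p. 368). [folklore] -/
theorem exists_outputsWithin_decide :
    ∃ M : TM2ComputableAux Γ' Bool, ∀ (k : ℕ) (φ : KCNF k),
      M.OutputsWithin φ.encode [decide φ.Satisfiable]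
        (79 * (2 ^ φ.numVars * (φ.encode.length + 1) ^ 3)) := by
  obtain ⟨M₀, h₀⟩ := inFST.timeComputable_eval
  obtain ⟨M₁, h₁⟩ := renFST.exists_iterate_outputsWithin
  obtain ⟨M₂, h₂⟩ := faFST.timeComputable_eval
  obtain ⟨M₃, h₃⟩ := countFST.exists_iterate_outputsWithin
  obtain ⟨M₄, h₄⟩ := outFST.timeComputable_eval
  refine ⟨(((M₀.comp M₁).comp M₂).comp M₃).comp M₄, fun k φ => ?_⟩
  have hX1 : 1 ≤ 2 ^ φ.numVars := Nat.one_le_two_pow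
  have hv : 2 ^ nv φ ≤ 2 ^ φ.numVars := Nat.pow_le_pow_right (by norm_num) (nv_le_numVars φ)
  have hdec : decide (∃ r < 2 ^ nv φ, formVal (counter (nv φ) r) (skel φ) = true) =
      decide φ.Satisfiable := by
    rw [Bool.eq_iff_iff, decide_eq_true_iff, decide_eq_true_iff, exists_counter_formVal_iff,
      exists_formVal_skel_iff]
  -- stage 1
  have H₀ : M₀.OutputsWithin φ.encode (inFST.eval φ.encode)
      (7 * (2 ^ φ.numVars * (φ.encode.length + 1) ^ 3)) := by
    have H := h₀ φ.encode
    change M₀.OutputsWithin φ.encode (inFST.eval φ.encode)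
      ((inFST.maxEmit + 1) * φ.encode.length + 3) at H
    refine H.mono ?_
    have e : (inFST.maxEmit + 1) * φ.encode.length ≤ 4 * φ.encode.length :=
      Nat.mul_le_mul_right _ (by have := inFST_maxEmit_le; omega)
    have := time₀_le (L := φ.encode.length) hX1
    omega
  -- stage 2
  have H₁ : M₁.OutputsWithin (inFST.eval φ.encode) (finalState (toks φ))
      (43 * (2 ^ φ.numVars * (φ.encode.length + 1) ^ 3)) := by
    have hB : ∀ i ≤ (inFST.eval φ.encode).countP Option.isNone,
        (renFST.eval^[i] ((inFST.eval φ.encode).reduceOption)).length ≤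
          2 ^ φ.numVars + (φ.encode.length + 1) ^ 2 := by
      intro i _
      rw [reduceOption_inFST_eval]
      exact (length_iterate_renFST_le (toks φ) i).trans (length_finalState_le φ)
    have H := h₁ (inFST.eval φ.encode) (2 ^ φ.numVars + (φ.encode.length + 1) ^ 2) hB
    rw [reduceOption_inFST_eval, countP_isNone_inFST_eval, renFST_iterate_final (toks φ) (rankPasses_le_two_mul φ)]
      at H
    refine H.mono ?_
    have e : (renFST.maxEmit + 3) * (2 ^ φ.numVars + (φ.encode.length + 1) ^ 2) + 6 ≤
        5 * (2 ^ φ.numVars + (φ.encode.length + 1) ^ 2) + 6 := by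
      have := Nat.mul_le_mul_right (2 ^ φ.numVars + (φ.encode.length + 1) ^ 2)
        (Nat.add_le_add_right renFST_maxEmit_le 3)
      omega
    have e' := Nat.mul_le_mul_left (2 * φ.encode.length) e
    have := time₁_le hX1 (length_inFST_eval_le φ) (le_refl (2 ^ φ.numVars + (φ.encode.length + 1) ^ 2))
    omega
  -- stage 3
  have H₂ : M₂.OutputsWithin (finalState (toks φ)) (faFST.eval (finalState (toks φ)))
      (7 * (2 ^ φ.numVars * (φ.encode.length + 1) ^ 3)) := by
    have H := h₂ (finalState (toks φ))
    change M₂.OutputsWithin (finalState (toks φ)) (faFST.eval (finalState (toks φ)))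
      ((faFST.maxEmit + 1) * (finalState (toks φ)).length + 3) at H
    refine H.mono ?_
    have e : (faFST.maxEmit + 1) * (finalState (toks φ)).length ≤ 2 * (finalState (toks φ)).length :=
      Nat.mul_le_mul_right _ (by have := faFST_maxEmit_le; omega)
    have := time₂_le (L := φ.encode.length) hX1 (length_finalState_le φ)
    omega
  -- stage 4
  have H₃ : M₃.OutputsWithin (faFST.eval (finalState (toks φ))) [.mode true (decide φ.Satisfiable)]
      (17 * (2 ^ φ.numVars * (φ.encode.length + 1) ^ 3)) := by
    have hB : ∀ i ≤ (faFST.eval (finalState (toks φ))).countP Option.isNone,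
        (countFST.eval^[i] ((faFST.eval (finalState (toks φ))).reduceOption)).length ≤
          (φ.encode.length + 1) ^ 2 := by
      intro i _
      rw [reduceOption_faFST_eval]
      exact (length_iterate_countFST_le (skel φ) (wf_skel φ) i).trans (length_runState_le φ)
    have H := h₃ (faFST.eval (finalState (toks φ))) ((φ.encode.length + 1) ^ 2) hB
    rw [reduceOption_faFST_eval, countP_isNone_faFST_eval, countFST_iterate_of_le (skel φ) (wf_skel φ) le_rfl, hdec] at H
    refine H.mono ?_
    have e : (countFST.maxEmit + 3) * (φ.encode.length + 1) ^ 2 + 6 ≤ 4 * (φ.encode.length + 1) ^ 2 + 6 := by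
      have := Nat.mul_le_mul_right ((φ.encode.length + 1) ^ 2) (Nat.add_le_add_right countFST_maxEmit_le 3)
      omega
    have e' := Nat.mul_le_mul_left (2 ^ nv φ) e
    have := time₃_le hX1 ((length_faFST_eval_le _).trans (length_finalState_le φ))
      (le_refl ((φ.encode.length + 1) ^ 2)) hv
    omega
  -- stage 5
  have H₄ : M₄.OutputsWithin [.mode true (decide φ.Satisfiable)] [decide φ.Satisfiable]
      (5 * (2 ^ φ.numVars * (φ.encode.length + 1) ^ 3)) := by
    have H := h₄ [.mode true (decide φ.Satisfiable)]
    change M₄.OutputsWithin [.mode true (decide φ.Satisfiable)] (outFST.eval [.mode true (decide φ.Satisfiable)])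
      ((outFST.maxEmit + 1) * 1 + 3) at H
    rw [outFST_eval_mode] at H
    refine H.mono ?_
    have := outFST_maxEmit_le
    obtain ⟨m1, -⟩ := monomials_le (L := φ.encode.length) hX1
    omega
  have := TM2ComputableAux.comp_outputsWithin _ _
    (TM2ComputableAux.comp_outputsWithin _ _
      (TM2ComputableAux.comp_outputsWithin _ _ (TM2ComputableAux.comp_outputsWithin _ _ H₀ H₁) H₂)
      H₃) H₄
  refine this.mono ?_
  omega

end Literature.Computability.FineGrained.BruteForce

/-! ### Discharge of `kSATInExpTime_one` and of the elementary exponent facts -/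

namespace Literature.Computability.FineGrained

open _root_.Computability

/-- **Discharge of the named fact `kSATInExpTime_one`**: for every `k`, `k`-SAT is decidable in
time `2ⁿ · poly(L)` (`n` the number of variables, `L` the input length), by the brute-force
machine `BruteForce.exists_outputsWithin_decide` (`79 · 2ⁿ · (L + 1)³` steps), so that `1` lies
in the set defining `s_k` (Impagliazzo–Paturi 2001, §1, p. 368: definition of `s_k` as an
infimum of exponents; the membership of `1` is implicit there).
[cite: ImpagliazzoPaturiJCSS2001, §1, p. 368 (definition of s_k; s_k ≤ 1 implicit)] -/
theorem kSATInExpTime_one_holds : kSATInExpTime_one := by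
  intro k
  obtain ⟨M, hM⟩ := BruteForce.exists_outputsWithin_decide
  refine ⟨fun n L => 79 * (2 ^ n * (L + 1) ^ 3), ⟨79, fun n L => ?_⟩, M, fun φ => hM k φ⟩
  show ((79 * (2 ^ n * (L + 1) ^ 3) : ℕ) : ℝ) ≤ (79 : ℕ) * (2 : ℝ) ^ ((1 : ℝ) * n) * ((L : ℝ) + 1) ^ (79 : ℕ)
  have hL : (1 : ℝ) ≤ (L : ℝ) + 1 := by
    have := L.cast_nonneg (α := ℝ)
    linarith
  rw [one_mul, Real.rpow_natCast]
  push_cast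
  have h3 : ((L : ℝ) + 1) ^ 3 ≤ ((L : ℝ) + 1) ^ 79 := pow_le_pow_right₀ hL (by norm_num)
  have h2 : (0 : ℝ) ≤ 2 ^ n := by positivity
  calc (79 : ℝ) * (2 ^ n * ((L : ℝ) + 1) ^ 3) ≤ 79 * (2 ^ n * ((L : ℝ) + 1) ^ 79) :=
        mul_le_mul_of_nonneg_left (mul_le_mul_of_nonneg_left h3 h2) (by norm_num)
    _ = 79 * 2 ^ n * ((L : ℝ) + 1) ^ 79 := by ring

/-- **Discharge of `satExponent_mem_Icc`**: `0 ≤ s_k ≤ 1` for every `k` (the set defining `s_k`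
contains `1` by `kSATInExpTime_one_holds`). (Impagliazzo–Paturi 2001, §1, p. 368.)
[cite: ImpagliazzoPaturiJCSS2001, §1, p. 368] -/
theorem satExponent_mem_Icc_holds : satExponent_mem_Icc :=
  satExponent_mem_Icc_of_kSATInExpTime_one kSATInExpTime_one_holds

/-- **Discharge of `monotone_satExponent`**: `(s_k)` is non-decreasing. (Impagliazzo–Paturi
2001, §1, p. 369: "the non-decreasing sequence `s_k`".) [cite: ImpagliazzoPaturiJCSS2001, §1, p. 369] -/
theorem monotone_satExponent_holds : monotone_satExponent :=
  monotone_satExponent_of_kSATInExpTime_one kSATInExpTime_one_holds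

/-- **Discharge of `eth_iff_satExponent_pos`** (**fine-grained.S02** in printed form):
`ETH ↔ s_3 > 0`. (Impagliazzo–Paturi 2001, p. 368: definition of `s_k` and Theorem 1 (1)⇔(3).)
[cite: ImpagliazzoPaturiJCSS2001, p. 368, Theorem 1] -/
theorem eth_iff_satExponent_pos_holds : eth_iff_satExponent_pos :=
  eth_iff_satExponent_pos_of_kSATInExpTime_one kSATInExpTime_one_holds

/-- **Discharge of `seth_iff_satExponentLimit_eq_one`** (**fine-grained.S01** in printed form):
`SETH ↔ s_∞ = 1`. (Impagliazzo–Paturi 2001, §1; Calabro–Impagliazzo–Paturi, IWPEC 2009.)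
[cite: CalabroImpagliazzoPaturiIWPEC2009] -/
theorem seth_iff_satExponentLimit_eq_one_holds : seth_iff_satExponentLimit_eq_one :=
  seth_iff_satExponentLimit_eq_one_of_kSATInExpTime_one kSATInExpTime_one_holds

/-- **fine-grained.S04, reduced to Theorem 3.** Assuming ETH, the sequence `(s_k)` increases
infinitely often (the named fact `ETH.frequently_satExponent_lt`) — from Impagliazzo–Paturi's
Theorem 3 `satExponent_le_satExponentLimit` (`s_k ≤ (1 - d/k) s_∞`) alone, the brute-force
bound being discharged. (Impagliazzo–Paturi 2001, abstract and p. 369.)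
[cite: ImpagliazzoPaturiJCSS2001, abstract and p. 369 (unnumbered consequence of Theorem 3)] -/
theorem ETH.frequently_satExponent_lt_of_satExponent_le_satExponentLimit
    (h₃ : satExponent_le_satExponentLimit) : ETH.frequently_satExponent_lt :=
  ETH.frequently_satExponent_lt_of kSATInExpTime_one_holds h₃

end Literature.Computability.FineGrained
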